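import Literature.Analysis.FluidPDE.TsaiSelfSimilarBounded
import Literature.Analysis.FluidPDE.ChaeAsymptoticallySelfSimilarProfile
import Literature.Analysis.FluidPDE.AdaptedBackwardKernel
import Literature.Analysis.FluidPDE.SelfSimilar
import HarnessLib

/-!
# Crux `FrequencyRigidity` (stmt-NavierStokesRegularity-2955), line `two-ended-pinning`:
# Stub 3 (`stub_flatEnstrophyLiouville`), the SELF-SIMILAR LEAF (`α = 0` anchor)

Helper file (`--supports stmt-NavierStokesRegularity-2955`; theorems only).  Stub 3 of the picked
line forbids a FLAT INHABITANT: a classical ancient Navier–Stokes flow `(v, q)` on `ℝ³ × (−∞,0)`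
(`ν > 0`) with the global time-Type-I bound `‖v(t,x)‖ ≤ C/√(−t)`, the scale-invariant derivative
bounds, an adapted two-sided Gaussian-comparable backward kernel `K` at `(0,0)`, and the EXACT
self-similar enstrophy law `∫ ‖curl v(t)‖² K(t) = A(−t)^{−2}`, `A > 0` (plus the transport-free
first variation).  This file closes its exactly-backward-self-similar sub-case: if moreover
`v(t) = (−t)^{−1/2} U(x/√(−t))` for `t < 0` (`v t = lerayBackward ½ 0 U t`, the tree's Leray
ansatz with `a = ½`, `T = 0`), then there is no such inhabitant.  Proof: `U = v(−1)` is smooth and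
bounded by `C`; Leray's reduction with a free pressure
(`isLerayProfile_of_isClassical_lerayBackward`) makes `(U, q(−1))` a Leray profile with `a = ½`;
Tsai 1998 Thm 1 at `q = ∞` (`tsai_selfsimilar_bounded_holds`, PROVED in the tree) makes `U`
constant; hence `curl v(t) ≡ 0` and the adapted enstrophy vanishes, contradicting
`A(−t)^{−2} > 0`.  This is the `α = 0` end of the wall the stub contains (bounded-profile backward
ROTATED self-similar Liouville for `α ≠ 0` is Pineau–Vicol 2026 Conj. 1.1 = Bradshaw–Tsai OP 5.2).

## References

* T.-P. Tsai, Arch. Rational Mech. Anal. 143 (1998) 29–51, Theorem 1 (p. 31). [Tsai1998]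
* J. Leray, Acta Math. 63 (1934), §20 (3.11)–(3.12). [Leray1934]
-/

noncomputable section

namespace Summit.NavierStokesRegularity.NavierStokesRegularity.Theorems.FrequencyRigidity.TwoEndedPinning

open Literature.Analysis.FluidPDE MeasureTheory Set Filter Topology Function
open scoped RealInnerProductSpace Laplacian ContDiff

/-- Classical solutions only see the velocity through its slices on the time set: replacing `u`
by a field `w` with `w t = u t` for `t ∈ S` keeps `(w, p)` a classical solution (joint smoothness
by `ContDiffOn.congr` on `S ×ˢ univ`; the one-sided time derivative within `S` by
`derivWithin_congr`). [folklore] -/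
theorem isClassicalNSSolutionOn_congr_velocity {S : Set ℝ} {ν : ℝ}
    {f u w : ℝ → EuclideanSpace ℝ (Fin 3) → EuclideanSpace ℝ (Fin 3)}
    {p : ℝ → EuclideanSpace ℝ (Fin 3) → ℝ} (h : IsClassicalNSSolutionOn S ν f u p)
    (hwu : ∀ t ∈ S, w t = u t) : IsClassicalNSSolutionOn S ν f w p where
  smooth_velocity := by
    refine h.smooth_velocity.congr fun z hz => ?_
    obtain ⟨t, x⟩ := z
    change w t x = u t x
    rw [hwu t (mem_prod.1 hz).1]
  smooth_pressure := h.smooth_pressure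
  momentum t ht x := by
    have hm := h.momentum t ht x
    have hd : timeDerivWithin S w t x = timeDerivWithin S u t x := by
      simp only [timeDerivWithin_apply]
      exact derivWithin_congr (fun s hs => by rw [hwu s hs]) (by rw [hwu t ht])
    rw [hd, hwu t ht]
    exact hm
  divFree t ht := by
    rw [hwu t ht]
    exact h.divFree t ht

/-- The curl of a constant field vanishes. [folklore] -/
theorem curl_fun_const (c x : EuclideanSpace ℝ (Fin 3)) : curl (fun _ => c) x = 0 := by
  simp [curl]

/-- **Registered sub-goal `stub_flatEnstrophyLiouville_selfSimilar` — the self-similar leaf of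
Stub 3 of line `two-ended-pinning`.**  A flat inhabitant (the nine clauses of the lead's
`IsFlatInhabitant`, verbatim and expanded) whose velocity is EXACTLY backward self-similar about
`(0,0)`, `v t = lerayBackward ½ 0 U t` for `t < 0`, does not exist: `U = v(−1)` is a smooth Leray
profile (`a = ½`, free pressure `q(−1)`; `isLerayProfile_of_isClassical_lerayBackward`) bounded by
the Type-I constant `C`, hence constant by Tsai 1998 Thm 1, `q = ∞`
(`tsai_selfsimilar_bounded_holds`); so `curl v(−1) ≡ 0` and the adapted enstrophy at `t = −1` is
`0`, while the flat law says it is `A · 1 = A > 0`. [cite: Tsai1998, Thm 1 (p. 31)] -/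
theorem stub_flatEnstrophyLiouville_selfSimilar :
    ∀ (ν C A : ℝ) (C' : ℕ → ℝ) (v : ℝ → EuclideanSpace ℝ (Fin 3) → EuclideanSpace ℝ (Fin 3))
      (q : ℝ → EuclideanSpace ℝ (Fin 3) → ℝ) (K : ℝ → EuclideanSpace ℝ (Fin 3) → ℝ)
      (U : EuclideanSpace ℝ (Fin 3) → EuclideanSpace ℝ (Fin 3)),
      (0 < ν ∧ Literature.Analysis.FluidPDE.IsClassicalNSSolutionOn (Set.Iio 0) ν 0 v q ∧
          Literature.Analysis.FluidPDE.HasTypeITimeDecay C v ∧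
          (∀ k : ℕ, 1 ≤ k → ∀ t : ℝ, t < 0 → ∀ x : EuclideanSpace ℝ (Fin 3),
            ‖iteratedFDeriv ℝ k (v t) x‖ ≤ C' k * (-t) ^ (-((k : ℝ) + 1) / 2)) ∧
          Literature.Analysis.FluidPDE.IsAdaptedBackwardKernel ν v (Set.Iio 0) 0 0 K ∧
          Literature.Analysis.FluidPDE.IsGaussianComparable K (Set.Iio 0) 0 0 ∧ 0 < A ∧
          (∀ t : ℝ, t < 0 →
            Literature.Analysis.FluidPDE.adaptedEnstrophy v K t = A * (-t) ^ (-(2 : ℝ))) ∧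
          (∀ t : ℝ, t < 0 →
            HasDerivAt (Literature.Analysis.FluidPDE.adaptedEnstrophy v K)
              (∫ x, (2 * (inner ℝ (Literature.Analysis.FluidPDE.curl (v t) x)
                            (fderiv ℝ (v t) x (Literature.Analysis.FluidPDE.curl (v t) x))
                          - ν * Literature.Analysis.FluidPDE.frobeniusNormSq
                            (fderiv ℝ (Literature.Analysis.FluidPDE.curl (v t)) x))) * K t x) t)) →
      (∀ t : ℝ, t < 0 → v t = Literature.Analysis.FluidPDE.lerayBackward (1 / 2) 0 U t) →
      False := by
  intro ν C A C' v q K U h hss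
  obtain ⟨hν, hNS, hTI, -, -, -, hA, hflat, -⟩ := h
  have hhalf : (0 : ℝ) < 1 / 2 := by norm_num
  -- the self-similar field is a classical solution with the same (free) pressure
  have hNS' : IsClassicalNSSolutionOn (Iio 0) ν 0 (lerayBackward (1 / 2) 0 U) q :=
    isClassicalNSSolutionOn_congr_velocity hNS fun t ht => (hss t ht).symm
  -- `U = v(−1)`
  have ht₀ : (0 : ℝ) - (2 * (1 / 2 : ℝ))⁻¹ = -1 := by norm_num
  have hU : lerayBackward (1 / 2) 0 U (-1) = U := by
    have h1 := lerayBackward_apply_sub_inv hhalf 0 U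
    rwa [ht₀] at h1
  have hvU : v (-1) = U := (hss (-1) (by norm_num)).trans hU
  have hUs : ContDiff ℝ ∞ U := hvU ▸ hNS.contDiff_velocity (show (-1 : ℝ) ∈ Iio 0 by norm_num)
  -- Leray's reduction: `(U, q(−1))` is a profile with `a = ½`
  have hint : (0 : ℝ) - (2 * (1 / 2 : ℝ))⁻¹ ∈ interior (Iio (0 : ℝ)) := by
    rw [interior_Iio, ht₀]; norm_num
  have hprof : IsLerayProfile ν (1 / 2) U (q ((0 : ℝ) - (2 * (1 / 2 : ℝ))⁻¹)) :=
    isLerayProfile_of_isClassical_lerayBackward hhalf hUs hint hNS'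
  -- boundedness of the profile from the Type-I bound at `t = −1`
  have hUb : ∃ M : ℝ, ∀ y, ‖U y‖ ≤ M := by
    refine ⟨C, fun y => ?_⟩
    have h1 := hTI (-1) (by norm_num) y
    rw [hvU] at h1
    simpa using h1
  -- Tsai 1998, Theorem 1 (`q = ∞`): the profile is constant
  obtain ⟨c, hc⟩ := tsai_selfsimilar_bounded_holds hν hhalf hprof hUb
  -- hence the flow is irrotational at `t = −1`
  have hcurl : ∀ x, curl (v (-1)) x = 0 := fun x => by
    have hUc : U = fun _ => c := funext hc
    rw [hvU, hUc]
    exact curl_fun_const c x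
  have hH0 : adaptedEnstrophy v K (-1) = 0 := by
    rw [adaptedEnstrophy_apply]
    simp [hcurl]
  -- but the flat law gives `H(−1) = A > 0`
  have h1 := hflat (-1) (by norm_num)
  rw [hH0] at h1
  norm_num at h1
  exact absurd h1.symm hA.ne'

end Summit.NavierStokesRegularity.NavierStokesRegularity.Theorems.FrequencyRigidity.TwoEndedPinning

end
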